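import Literature.AlgebraicGeometry.Hu2025.Proofs.S03Pluecker.GammaQuadMatroid
import Mathlib.LinearAlgebra.Matrix.NonsingularInverse
import Mathlib.LinearAlgebra.Matrix.ToLin
import HarnessLib

/-!
# Hu 2025 — the certificate point `Q` of the complete quadrilateral as a `ℚ`-POINT OF `Gr(3,9)`: the `3`-plane
# `quadPlane ≤ ℚ⁹` spanned by the rows of `[I₃ | A(Q)]`, and the determinant criterion for Plücker non-vanishing
# (joint J1 / GAP-LEDGER-HU row HU-R01 — kernel support, OURS; prepares the row-110c reading `PlueckerNonzero` /
# `VertexMem` of Prop. 9.1 for this configuration)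

**HONEST FRAMING (D-0012/D-0089).** [Hu2025] is an unrefereed preprint under adjudication; nothing of it is asserted. This file is
linear algebra about OUR objects: (1) `bijective_restrict_rowSpan_iff` — for a matrix `B` with independent rows, restriction
of the row span to a set of `|rows|` coordinates is bijective iff the corresponding square submatrix is invertible (the
determinant form of «`p_u ≠ 0`», Prop. 9.1 p.160, as row 110c reads it at field-valued points: `PlueckerNonzero`); (2) the
integer matrix `[I₃ | A(T)]` of a table `T` (`colZ`, `colMatZ`) with `minorZ T u = det` (`minorZ_eq_det`, cf.
`GammaQuadMatroid.evalAt_chartMinor`); (3) for the certificate point `Q` (`quadPointQexact`): `quadMatrix = [I₃ | A(Q)]` over `ℚ`,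
its row span `quadPlane` has `dim 3` (`finrank_quadPlane`), and on the columns of any `u ∈ 𝕀_{3,9}` the determinant is non-zero
iff `u ∉ Γ = {456, 478, 579, 689}` (`det_quadMatrix_submatrix_ne_zero_iff`) — i.e. `quadPlane` is a `ℚ`-point of the Grassmannian
whose vanishing Plücker coordinates are EXACTLY `Γ` (the rank-3 matroid on `[9]` with non-bases `Γ`). AI proof is weaker than
expert review.
-/

noncomputable section

namespace Literature.AlgebraicGeometry.Hu2025.Statements.S03Pluecker

open Matrix

section RowSpan

variable {K : Type*} [Field K] {m n : Type*} [Fintype m] [DecidableEq m]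

/-- **Determinant criterion for the Plücker-nonvanishing predicate of row 110c** (`S01S09Interface.PlueckerNonzero K F u :=
Bijective (v ↦ v|_u)`), for a row span: for `B : Matrix m n K` with injective `vecMul` (independent rows) and a set of columns `u` in bijection with `m`
via `e`, restriction to the `u`-coordinates is bijective on the row span of `B` iff the square submatrix on the columns
`u` is a unit. OURS (linear algebra).
[cite: Hu2025, Prop. 9.1 «p_i ≠ 0» (chunk p0072 l.77–80; PDF p.160); joint J1 = GAP-LEDGER-HU row HU-R01 (unrefereed preprint arXiv:2507.21400v1 under adjudication, D-0012/D-0089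
— kernel support on OUR typed carriers of rows 101/110; nothing of the source asserted)] -/
theorem bijective_restrict_rowSpan_iff (B : Matrix m n K) (hB : Function.Injective B.vecMul)
    (u : Finset n) (e : m ≃ ↥u) :
    Function.Bijective (fun v : ↥(Submodule.span K (Set.range B.row)) => fun i : ↥u => (v : n → K) i) ↔
      IsUnit (B.submatrix id (fun j : m => ((e j : ↥u) : n))) := by
  set Bu : Matrix m m K := B.submatrix id (fun j : m => ((e j : ↥u) : n)) with hBu
  -- the row span is the range of `vecMulLinear`
  have hF : Submodule.span K (Set.range B.row) = LinearMap.range B.vecMulLinear :=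
    (range_vecMulLinear B).symm
  -- parametrisation of the row span by coefficient vectors
  let φ : (m → K) → ↥(Submodule.span K (Set.range B.row)) :=
    fun c => ⟨c ᵥ* B, by rw [hF]; exact ⟨c, rfl⟩⟩
  have hφ : Function.Bijective φ := by
    constructor
    · intro c c' h
      exact hB (congrArg Subtype.val h)
    · rintro ⟨v, hv⟩
      rw [hF] at hv
      obtain ⟨c, rfl⟩ := hv
      exact ⟨c, rfl⟩
  -- restriction after parametrisation is `vecMul` by the submatrix, up to the reindexing `e`
  let ρ : (↥u → K) → (m → K) := fun w j => w (e j)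
  have hρ : Function.Bijective ρ := by
    refine (Equiv.mk ρ (fun c i => c (e.symm i)) ?_ ?_).bijective
    · intro w; funext i; simp [ρ]
    · intro c; funext j; simp [ρ]
  have hcomp : (fun c : m → K => c ᵥ* Bu) =
      ρ ∘ (fun v : ↥(Submodule.span K (Set.range B.row)) => fun i : ↥u => (v : n → K) i) ∘ φ := by
    funext c j
    simp only [Function.comp_apply, ρ, φ, hBu, vecMul, dotProduct, submatrix_apply, id_eq]
  constructor
  · intro hres
    have hbij : Function.Bijective (fun c : m → K => c ᵥ* Bu) := by
      rw [hcomp]; exact hρ.comp (hres.comp hφ)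
    exact vecMul_injective_iff_isUnit.mp hbij.1
  · intro hunit
    have hbij : Function.Bijective (fun c : m → K => c ᵥ* Bu) :=
      ⟨vecMul_injective_iff_isUnit.mpr hunit, vecMul_surjective_iff_isUnit.mpr hunit⟩
    rw [hcomp] at hbij
    -- cancel the bijections ρ (left) and φ (right)
    have h1 : Function.Bijective ((fun v : ↥(Submodule.span K (Set.range B.row)) => fun i : ↥u => (v : n → K) i) ∘ φ) :=
      (Function.Bijective.of_comp_iff' hρ _).mp hbij
    exact (Function.Bijective.of_comp_iff _ hφ).mp h1

end RowSpan

/-- **Integer column `a` of `[I₃ | A(T)]`** (mirror of row 101b's `chartCol` with the basic variables replaced by the table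
values): columns `1, 2, 3` the unit vectors, column `a > 3` equal to `(T(2,3,a), −T(1,3,a), T(1,2,a))`. OURS plumbing.
[cite: Hu2025, Prop. 9.1 (Γ_d, Gr_d) p.160 and Def. 7.1 (Z_Γ) p.128; joint J1 = GAP-LEDGER-HU row HU-R01 (unrefereed preprint arXiv:2507.21400v1 under adjudication, D-0012/D-0089
— kernel support on OUR typed carriers of rows 101/110; nothing of the source asserted)] -/
def colZ (T : ℕ × ℕ × ℕ → ℤ) (a : ℕ) : Fin 3 → ℤ :=
  if a = 1 then ![1, 0, 0] else if a = 2 then ![0, 1, 0] else if a = 3 then ![0, 0, 1]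
  else ![T (2, 3, a), -T (1, 3, a), T (1, 2, a)]

/-- **The `3 × 3` integer matrix of `[I₃ | A(T)]` on the columns `u = (u₁,u₂,u₃)`** (ROWS = those columns, as `chartMinor`).
[cite: Hu2025, Prop. 9.1 (Γ_d, Gr_d) p.160 and Def. 7.1 (Z_Γ) p.128; joint J1 = GAP-LEDGER-HU row HU-R01 (unrefereed preprint arXiv:2507.21400v1 under adjudication, D-0012/D-0089
— kernel support on OUR typed carriers of rows 101/110; nothing of the source asserted)] -/
def colMatZ (T : ℕ × ℕ × ℕ → ℤ) (u : ℕ × ℕ × ℕ) : Matrix (Fin 3) (Fin 3) ℤ :=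
  Matrix.of ![colZ T u.1, colZ T u.2.1, colZ T u.2.2]

/-- **`minorZ T u` IS the determinant of `[I₃ | A(T)]` on the columns `u`**, for every chart index `u ∈ 𝕀_{3,n} ∖ m`
(seven shape cases, `det_fin_three`).
[cite: Hu2025, Prop. 9.1 (Γ_d, Gr_d) p.160 and Def. 7.1 (Z_Γ) p.128; joint J1 = GAP-LEDGER-HU row HU-R01 (unrefereed preprint arXiv:2507.21400v1 under adjudication, D-0012/D-0089
— kernel support on OUR typed carriers of rows 101/110; nothing of the source asserted)] -/
theorem minorZ_eq_det (T : ℕ × ℕ × ℕ → ℤ) {n : ℕ} {u : ℕ × ℕ × ℕ} (hu : u ∈ plVarSet n) :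
    minorZ T u = (colMatZ T u).det := by
  obtain ⟨a, b, c⟩ := u
  have hne : (a, b, c) ≠ mTri := (Finset.mem_erase.mp hu).1
  have hidx := mem_plIndexSet_iff.mp (Finset.mem_erase.mp hu).2
  simp only at hidx
  unfold mTri at hne
  simp only [ne_eq, Prod.mk.injEq] at hne
  -- shape analysis
  have ha : a = 1 ∨ a = 2 ∨ a = 3 ∨ 3 < a := by omega
  rcases ha with rfl | rfl | rfl | ha
  · -- a = 1
    have hb : b = 2 ∨ b = 3 ∨ 3 < b := by omega
    rcases hb with rfl | rfl | hb
    · have hc : 3 < c := by omega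
      have hc1 : c ≠ 1 := by omega
      have hc2 : c ≠ 2 := by omega
      have hc3 : c ≠ 3 := by omega
      simp [minorZ, colMatZ, colZ, hc1, hc2, hc3, Matrix.det_fin_three]
    · have hc : 3 < c := by omega
      have hc1 : c ≠ 1 := by omega
      have hc2 : c ≠ 2 := by omega
      have hc3 : c ≠ 3 := by omega
      simp [minorZ, colMatZ, colZ, hc1, hc2, hc3, Matrix.det_fin_three]
    · have hb1 : b ≠ 1 := by omega
      have hb2 : b ≠ 2 := by omega
      have hb3 : b ≠ 3 := by omega
      have hc1 : c ≠ 1 := by omega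
      have hc2 : c ≠ 2 := by omega
      have hc3 : c ≠ 3 := by omega
      simp [minorZ, colMatZ, colZ, hb1, hb2, hb3, hc1, hc2, hc3, Matrix.det_fin_three]
      ring
  · -- a = 2
    have hb : b = 3 ∨ 3 < b := by omega
    rcases hb with rfl | hb
    · have hc1 : c ≠ 1 := by omega
      have hc2 : c ≠ 2 := by omega
      have hc3 : c ≠ 3 := by omega
      simp [minorZ, colMatZ, colZ, hc1, hc2, hc3, Matrix.det_fin_three]
    · have hb1 : b ≠ 1 := by omega
      have hb2 : b ≠ 2 := by omega
      have hb3 : b ≠ 3 := by omega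
      have hc1 : c ≠ 1 := by omega
      have hc2 : c ≠ 2 := by omega
      have hc3 : c ≠ 3 := by omega
      simp [minorZ, colMatZ, colZ, hb1, hb2, hb3, hc1, hc2, hc3, Matrix.det_fin_three]
      ring
  · -- a = 3
    have hb1 : b ≠ 1 := by omega
    have hb2 : b ≠ 2 := by omega
    have hb3 : b ≠ 3 := by omega
    have hc1 : c ≠ 1 := by omega
    have hc2 : c ≠ 2 := by omega
    have hc3 : c ≠ 3 := by omega
    simp [minorZ, colMatZ, colZ, hb1, hb2, hb3, hc1, hc2, hc3, Matrix.det_fin_three]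
    ring
  · -- 3 < a
    have ha1 : a ≠ 1 := by omega
    have ha2 : a ≠ 2 := by omega
    have ha3 : a ≠ 3 := by omega
    have hb1 : b ≠ 1 := by omega
    have hb2 : b ≠ 2 := by omega
    have hb3 : b ≠ 3 := by omega
    have hc1 : c ≠ 1 := by omega
    have hc2 : c ≠ 2 := by omega
    have hc3 : c ≠ 3 := by omega
    simp [minorZ, colMatZ, colZ, ha1, ha2, ha3, hb1, hb2, hb3, hc1, hc2, hc3, Matrix.det_fin_three]
    ring

/-- **The chart-index matrices of the certificate point `Q` have determinant `0` exactly on `Γ`** (`u ∈ 𝕀_{3,9} ∖ m`).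
[cite: Hu2025, Prop. 9.1 (Γ_d, Gr_d) p.160 and Def. 7.1 (Z_Γ) p.128; joint J1 = GAP-LEDGER-HU row HU-R01 (unrefereed preprint arXiv:2507.21400v1 under adjudication, D-0012/D-0089
— kernel support on OUR typed carriers of rows 101/110; nothing of the source asserted)] -/
theorem det_colMatZ_quadPointQexact_eq_zero_iff {u : ℕ × ℕ × ℕ} (hu : u ∈ plVarSet 9) :
    (colMatZ quadPointQexact u).det = 0 ↔ u ∈ quadGamma := by
  rw [← minorZ_eq_det quadPointQexact hu, minorZ_quadPointQexact_eq_zero_iff u hu, mem_quadGammaFin_iff]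

/-! ## The rational `3 × 9` matrix `[I₃ | A(Q)]` of the certificate point and its row span (a `ℚ`-point of `Gr(3,9)`) -/

/-- **`[I₃ | A(Q)]` over `ℚ`** (`3 × 9`; column `j` = `colZ Q (j+1)`). OURS.
[cite: Hu2025, Prop. 9.1 (Γ_d, Gr_d) p.160 and Def. 7.1 (Z_Γ) p.128; joint J1 = GAP-LEDGER-HU row HU-R01 (unrefereed preprint arXiv:2507.21400v1 under adjudication, D-0012/D-0089
— kernel support on OUR typed carriers of rows 101/110; nothing of the source asserted)] -/
def quadMatrix : Matrix (Fin 3) (Fin 9) ℚ := fun i j => (colZ quadPointQexact (j.val + 1) i : ℚ)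

/-- The first three columns of `[I₃ | A(Q)]` are the identity: `(c ᵥ* quadMatrix) j = c j` for `j < 3`.
[cite: Hu2025, Prop. 9.1 (Γ_d, Gr_d) p.160 and Def. 7.1 (Z_Γ) p.128; joint J1 = GAP-LEDGER-HU row HU-R01 (unrefereed preprint arXiv:2507.21400v1 under adjudication, D-0012/D-0089
— kernel support on OUR typed carriers of rows 101/110; nothing of the source asserted)] -/
theorem quadMatrix_vecMul_frame (c : Fin 3 → ℚ) (i : Fin 3) :
    (c ᵥ* quadMatrix) (Fin.castLE (by norm_num) i) = c i := by
  fin_cases i <;>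
    simp [quadMatrix, Matrix.vecMul, dotProduct, colZ, Fin.sum_univ_three]

/-- **The rows of `[I₃ | A(Q)]` are independent** (`vecMul` is injective).
[cite: Hu2025, Prop. 9.1 (Γ_d, Gr_d) p.160 and Def. 7.1 (Z_Γ) p.128; joint J1 = GAP-LEDGER-HU row HU-R01 (unrefereed preprint arXiv:2507.21400v1 under adjudication, D-0012/D-0089
— kernel support on OUR typed carriers of rows 101/110; nothing of the source asserted)] -/
theorem quadMatrix_vecMul_injective : Function.Injective quadMatrix.vecMul := by
  intro c c' h
  funext i
  rw [← quadMatrix_vecMul_frame c i, ← quadMatrix_vecMul_frame c' i]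
  exact congrFun h _

/-- **The `ℚ`-plane of the certificate point**: the row span of `[I₃ | A(Q)]` in `ℚ⁹`. OURS.
[cite: Hu2025, Prop. 9.1 (Γ_d, Gr_d) p.160 and Def. 7.1 (Z_Γ) p.128; joint J1 = GAP-LEDGER-HU row HU-R01 (unrefereed preprint arXiv:2507.21400v1 under adjudication, D-0012/D-0089
— kernel support on OUR typed carriers of rows 101/110; nothing of the source asserted)] -/
def quadPlane : Submodule ℚ (Fin 9 → ℚ) := Submodule.span ℚ (Set.range quadMatrix.row)

/-- `dim_ℚ quadPlane = 3`.
[cite: Hu2025, Prop. 9.1 (Γ_d, Gr_d) p.160 and Def. 7.1 (Z_Γ) p.128; joint J1 = GAP-LEDGER-HU row HU-R01 (unrefereed preprint arXiv:2507.21400v1 under adjudication, D-0012/D-0089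
— kernel support on OUR typed carriers of rows 101/110; nothing of the source asserted)] -/
theorem finrank_quadPlane : Module.finrank ℚ quadPlane = 3 := by
  have hli : LinearIndependent ℚ quadMatrix.row := Matrix.vecMul_injective_iff.mp quadMatrix_vecMul_injective
  rw [quadPlane, finrank_span_eq_card hli, Fintype.card_fin]

/-- **Column selection for a triple** `u = (u₁,u₂,u₃)` with `1 ≤ uᵢ ≤ 9`: `j ↦ uⱼ − 1 : Fin 9`. OURS plumbing.
[cite: Hu2025, Prop. 9.1 (Γ_d, Gr_d) p.160 and Def. 7.1 (Z_Γ) p.128; joint J1 = GAP-LEDGER-HU row HU-R01 (unrefereed preprint arXiv:2507.21400v1 under adjudication, D-0012/D-0089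
— kernel support on OUR typed carriers of rows 101/110; nothing of the source asserted)] -/
def colSel (u : ℕ × ℕ × ℕ) : Fin 3 → Fin 9 :=
  ![⟨(u.1 - 1) % 9, Nat.mod_lt _ (by norm_num)⟩, ⟨(u.2.1 - 1) % 9, Nat.mod_lt _ (by norm_num)⟩,
    ⟨(u.2.2 - 1) % 9, Nat.mod_lt _ (by norm_num)⟩]

/-- On the columns of an index `u ∈ 𝕀_{3,9}`, `[I₃ | A(Q)]` restricts to the transpose of `colMatZ Q u` (cast to `ℚ`).
[cite: Hu2025, Prop. 9.1 (Γ_d, Gr_d) p.160 and Def. 7.1 (Z_Γ) p.128; joint J1 = GAP-LEDGER-HU row HU-R01 (unrefereed preprint arXiv:2507.21400v1 under adjudication, D-0012/D-0089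
— kernel support on OUR typed carriers of rows 101/110; nothing of the source asserted)] -/
theorem quadMatrix_submatrix_colSel {u : ℕ × ℕ × ℕ} (hu : u ∈ plIndexSet 9) :
    quadMatrix.submatrix id (colSel u) = ((colMatZ quadPointQexact u).transpose).map (Int.castRingHom ℚ) := by
  have hidx := mem_plIndexSet_iff.mp hu
  have h1 : (u.1 - 1) % 9 + 1 = u.1 := by omega
  have h2 : (u.2.1 - 1) % 9 + 1 = u.2.1 := by omega
  have h3 : (u.2.2 - 1) % 9 + 1 = u.2.2 := by omega
  ext i j
  fin_cases j <;>
    simp [quadMatrix, colSel, colMatZ, Matrix.submatrix_apply, Matrix.transpose_apply, h1, h2, h3]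

/-- **`det` of `[I₃ | A(Q)]` on the columns `u` is `minorZ Q u`** (`u ∈ 𝕀_{3,9} ∖ m`).
[cite: Hu2025, Prop. 9.1 (Γ_d, Gr_d) p.160 and Def. 7.1 (Z_Γ) p.128; joint J1 = GAP-LEDGER-HU row HU-R01 (unrefereed preprint arXiv:2507.21400v1 under adjudication, D-0012/D-0089
— kernel support on OUR typed carriers of rows 101/110; nothing of the source asserted)] -/
theorem det_quadMatrix_submatrix {u : ℕ × ℕ × ℕ} (hu : u ∈ plVarSet 9) :
    (quadMatrix.submatrix id (colSel u)).det = (minorZ quadPointQexact u : ℚ) := by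
  rw [quadMatrix_submatrix_colSel (Finset.mem_erase.mp hu).2, ← RingHom.mapMatrix_apply, ← RingHom.map_det,
    Matrix.det_transpose, ← minorZ_eq_det quadPointQexact hu]
  rfl

/-- **On the frame `m = (1,2,3)` the submatrix is the identity** (determinant `1`).
[cite: Hu2025, Prop. 9.1 (Γ_d, Gr_d) p.160 and Def. 7.1 (Z_Γ) p.128; joint J1 = GAP-LEDGER-HU row HU-R01 (unrefereed preprint arXiv:2507.21400v1 under adjudication, D-0012/D-0089
— kernel support on OUR typed carriers of rows 101/110; nothing of the source asserted)] -/
theorem det_quadMatrix_submatrix_mTri : (quadMatrix.submatrix id (colSel mTri)).det = 1 := by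
  have : quadMatrix.submatrix id (colSel mTri) = 1 := by
    ext i j
    fin_cases i <;> fin_cases j <;> simp [quadMatrix, colSel, mTri, colZ]
  rw [this, Matrix.det_one]

/-- **`det ≠ 0` on the columns `u ∈ 𝕀_{3,9}` iff `u ∉ Γ`** (the frame included: `m ∉ Γ`).
[cite: Hu2025, Prop. 9.1 (Γ_d, Gr_d) p.160 and Def. 7.1 (Z_Γ) p.128; joint J1 = GAP-LEDGER-HU row HU-R01 (unrefereed preprint arXiv:2507.21400v1 under adjudication, D-0012/D-0089
— kernel support on OUR typed carriers of rows 101/110; nothing of the source asserted)] -/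
theorem det_quadMatrix_submatrix_ne_zero_iff {u : ℕ × ℕ × ℕ} (hu : u ∈ plIndexSet 9) :
    (quadMatrix.submatrix id (colSel u)).det ≠ 0 ↔ u ∉ quadGamma := by
  by_cases hm : u = mTri
  · subst hm
    rw [det_quadMatrix_submatrix_mTri]
    simp [quadGamma, mTri]
  · have hu' : u ∈ plVarSet 9 := Finset.mem_erase.mpr ⟨hm, hu⟩
    rw [det_quadMatrix_submatrix hu', ne_eq, Int.cast_eq_zero, minorZ_quadPointQexact_eq_zero_iff u hu',
      mem_quadGammaFin_iff]

end Literature.AlgebraicGeometry.Hu2025.Statements.S03Pluecker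

end
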